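import Summits.QuantumFields.BalabanUV.Beta.FP.FineHessianGluonCore

/-!
# `BalabanUV.Beta.FP.KernelReflectionBoundedContact2` — road «FP» for binder row D1, sub-row **H2-ASM-5a (Kcov)** GLUON HALF: the bounded-leg reflection law of the resolvent
# Hessian when BOTH vertex slots reflect WITH CONTACT, and the ONE consistency identity under which the Hessian kernel is axis-reflection covariant
# (one notch past `KernelReflectionBoundedContact` §4, whose «cross words vanish» hypothesis the level-0 BF data do not meet termwise)

HONEST DEPENDENCY (page 1, mandatory): continuum YM on T⁴ ⇐ BetaPertH ∧ nine spine estimates (0/9 proved); BetaPertH ⇐ (D1) ∧ (D4) ∧ CAP+tail;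
G-an2-4 gates asym, D1 and NE2/3/4.  HONEST FRAMING (cell contract, verbatim): «discharging `BetaPertH` makes Bałaban's UV stability UNCONDITIONAL —
a real constructive-QFT result; it is NOT the continuum limit and NOT the Clay problem.»  THIS MODULE DISCHARGES NOTHING of the wall: [folklore] kernel bookkeeping
(BY NAME over `KernelReflectionBoundedContact` ∕ `KernelReflectionBounded` ∕ the owner's `FineHessianGluonCore.tadpole_add_right_bdd`);
no `def`, no `def … : Prop`, nothing cited, 0 sorry; 0∕4 row-D1 binders; NOT the (Kcov) letter of the literal (its inputs — the laws with contact of the perfect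
cubic ∕ quartic jets and the consistency identity at the perfect data — are H2V-4′'s and the W-slot's), NOT hgerm, NOT D1, NOT BetaPertH, NOT continuum, NOT Clay.

ABSOLUTE RULE (cell charter, verbatim): «No internally-minted statement may enter as a cited fact. Every hypothesis is either kernel-proved in this package or a
verbatim quotation of a PUBLISHED theorem with page reference. The manuscript(s) under audit are NOT citable for their own disputed steps — they are the thing
under adjudication; programme-internal (2001/route/tribunal) claims are never citable.»

WHY (located in `SliceVertexReflection`'s LANDED line, CLAIMS 2026-08-21 l.28065).  For the level-0 BF data the first-order family reflects with the contact
`ct_M = −[κ′=α]·[Π_{(u,κ′)}, M]` (`M` = the BF Hessian; `WilsonReflectionContact.wilsonA_bref`, `SliceVertexReflection.sliceA_bref` ∕ `bfCt_inl_inl`); at a leg `A` with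
`A∘M = M∘A = 1` the three bubble cross words of `KernelReflectionBoundedContact.hessKer_refl_bdd_contact` are LOCAL BUT NOT ZERO termwise — they are cancelled by the
tadpole of the second-order slot's OWN contact (the `(2,2)` jet's law carries one: an3's `WilsonJetReflection2.jet22_pull`, `reflDir₂`).  So the (Kcov)-gluon socket reads:
V-law with contact `CtV`, W-law with contact `CtW`, and `tadpole A (CtW μ 0 ν z) = Σ cross words(CtV)`.

WHAT ([folklore]; any `D`, finite fibre).
* §1 the tadpole's additivity in its TABLE for a bounded leg is the owner's `FineHessianGluonCore.tadpole_add_right_bdd` ✓ (BY NAME).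
* §2 **`hess_refl_bdd_contact₂`**: `Φ·A = A`, `V μ (ρ μ y) = σ μ • refK Φ (V μ y + CtV μ y)`, `W μ (ρ μ y) ν (ρ ν y′) = (σ μ σ ν) • refK Φ (W μ y ν y′ + CtW μ y ν y′)` ⟹ EXACTLY
  `hess μ (ρ μ y) ν (ρ ν y′) = σ μ σ ν·( hess μ y ν y′ + ½·tadpole A (CtW μ y ν y′) − ½·(bubble A (CtV μ y)(V ν y′) + bubble A (V μ y)(CtV ν y′) + bubble A (CtV μ y)(CtV ν y′)) )`.
* §3 `hessKer_refl_bdd_contact₂` — the difference-variable form under block covariance (bond map `bondRefl α c`, signs `reflSign α`).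
* §4 **`axisReflectionCovariant_flip_hessKer_bdd_contact₂`**: if for every axis `α` there are `Φα` (leaving `A` invariant), `c`, `CtVα`, `CtWα` with the two laws AND the
  CONSISTENCY IDENTITY `∀ μ ν z, tadpole A (CtWα μ 0 ν z) = bubble A (CtVα μ 0)(V ν z) + bubble A (V μ 0)(CtVα ν z) + bubble A (CtVα μ 0)(CtVα ν z)`, then
  `AxisReflectionCovariant (fun μ ν z => hessKer A V W μ ν (−z))`; `KernelReflectionBoundedContact` §4 is the case `CtW = 0`.
Provenance: D1 formalisation swarm seat b2b-balaban-beta-d1-formalise-leaf-02 gen 10 (road FP engine lineage), 2026-08-21.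
-/

noncomputable section

namespace Summit.QuantumFields.BalabanUV.Beta.FP.KernelReflectionBoundedContact2

open Finset
open scoped BigOperators
open Literature.MathematicalPhysics.QuantumFieldTheory.Balaban1983to89
open Literature.MathematicalPhysics.QuantumFieldTheory.Balaban1983to89.Beta
open B12Sec2to5 (l1 l1_nonneg)
open B6BondElimination (unitVec unitVec_apply)
open PolarizationSign (axisReflect axisReflect_apply reflSign AxisReflectionCovariant)
open ExpKernelCalculus (MKer Site BiLoc comp tr bubble tadpole VertexFamily VertexFamily₂ hess hessKer BlockCovariant hess_eq_hessKer)
open KernelReflection (LegMap refK refK_apply tadpole_smul bubble_smul_left bubble_smul_right bondRefl bondRefl_sub)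
open KernelWard (Bdd biLoc_add)
open Summit.QuantumFields.BalabanUV.Beta.FP.KernelReflectionBounded (bubble_refK_bdd tadpole_refK_bdd)
open Summit.QuantumFields.BalabanUV.Beta.FP.KernelReflectionBoundedContact (bubble_add_left_bdd bubble_add_right_bdd)
open Summit.QuantumFields.BalabanUV.Beta.FP.FineHessianGluonCore (tadpole_add_right_bdd)

variable {D : ℕ} {F : Type*} [Fintype F]

/-! ## §1 (The tadpole's additivity in its table for a bounded leg is the road owner's `FineHessianGluonCore.tadpole_add_right_bdd` ✓, used BY NAME below.) -/

/-! ## §2 Covariance of the Hessian when BOTH slots reflect with a contact -/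

/-- [folklore] **COVARIANCE OF THE RESOLVENT HESSIAN, BOUNDED LEG, BOTH LAWS WITH CONTACT.** If the bounded leg is relabelling-invariant (`Φ·A = A`), the first-order family obeys
`V μ (ρ μ y) = σ μ • refK Φ (V μ y + CtV μ y)` and the second-order family `W μ (ρ μ y) ν (ρ ν y′) = (σ μ σ ν) • refK Φ (W μ y ν y′ + CtW μ y ν y′)` with contact families localised
at the same bonds, then EXACTLY
`hess μ (ρ μ y) ν (ρ ν y′) = σ μ σ ν · (hess μ y ν y′ + ½·tadpole A (CtW μ y ν y′) − ½·(bubble A (CtV μ y) (V ν y′) + bubble A (V μ y) (CtV ν y′) + bubble A (CtV μ y) (CtV ν y′)))`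
— the W-contact's tadpole and the three V-contact cross words displayed, nothing assumed about them. -/
theorem hess_refl_bdd_contact₂ (Φ : LegMap D F) {A : MKer D F} {V CtV : Fin D → (Fin D → ℤ) → MKer D F}
    {W CtW : Fin D → (Fin D → ℤ) → Fin D → (Fin D → ℤ) → MKer D F} {B Cv Cc Cw Cc₂ δ : ℝ} {N : ℕ}
    (hA : Bdd A B) (hV : VertexFamily V N Cv δ) (hCtV : VertexFamily CtV N Cc δ) (hW : VertexFamily₂ W N Cw δ) (hCtW : VertexFamily₂ CtW N Cc₂ δ)
    (hδ : 0 < δ) (hAr : refK Φ A = A) (ρ : Fin D → (Fin D → ℤ) → (Fin D → ℤ)) (σ : Fin D → ℝ)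
    (hVr : ∀ μ y, V μ (ρ μ y) = σ μ • refK Φ (V μ y + CtV μ y))
    (hWr : ∀ μ y ν y', W μ (ρ μ y) ν (ρ ν y') = (σ μ * σ ν) • refK Φ (W μ y ν y' + CtW μ y ν y'))
    (μ : Fin D) (y : Fin D → ℤ) (ν : Fin D) (y' : Fin D → ℤ) :
    hess A V W μ (ρ μ y) ν (ρ ν y') = σ μ * σ ν * (hess A V W μ y ν y' + (1 / 2) * tadpole A (CtW μ y ν y')
      - (1 / 2) * (bubble A (CtV μ y) (V ν y') + bubble A (V μ y) (CtV ν y') + bubble A (CtV μ y) (CtV ν y'))) := by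
  unfold ExpKernelCalculus.hess
  rw [hWr, hVr, hVr, tadpole_smul, bubble_smul_left, bubble_smul_right]
  conv_lhs => rw [← hAr]
  rw [tadpole_refK_bdd Φ hA (biLoc_add (hW μ y ν y') (hCtW μ y ν y')) hδ, tadpole_add_right_bdd hA (hW μ y ν y') (hCtW μ y ν y') hδ,
    bubble_refK_bdd Φ hA (biLoc_add (hV μ y) (hCtV μ y)) (biLoc_add (hV ν y') (hCtV ν y')) hδ,
    bubble_add_left_bdd hA (hV μ y) (hCtV μ y) (biLoc_add (hV ν y') (hCtV ν y')) hδ,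
    bubble_add_right_bdd hA (hV μ y) (hV ν y') (hCtV ν y') hδ, bubble_add_right_bdd hA (hCtV μ y) (hV ν y') (hCtV ν y') hδ]
  ring

/-! ## §3 The difference-variable form -/

/-- [folklore] **THE DIFFERENCE-VARIABLE LAW WITH BOTH CONTACTS.** Under block-translation covariance of `(A, V, W)` and the hypotheses of `hess_refl_bdd_contact₂` for the bond map
`bondRefl α c` with signs `reflSign α`:
`hessKer μ ν (εz + [μ=α]e_α − [ν=α]e_α) = ε_μ ε_ν · (hessKer μ ν z + ½·tadpole A (CtW μ 0 ν z) − ½·(bubble A (CtV μ 0) (V ν z) + bubble A (V μ 0) (CtV ν z) + bubble A (CtV μ 0) (CtV ν z)))`. -/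
theorem hessKer_refl_bdd_contact₂ (Φ : LegMap D F) {A : MKer D F} {V CtV : Fin D → (Fin D → ℤ) → MKer D F}
    {W CtW : Fin D → (Fin D → ℤ) → Fin D → (Fin D → ℤ) → MKer D F} {B Cv Cc Cw Cc₂ δ : ℝ} {N : ℕ}
    (hA : Bdd A B) (hV : VertexFamily V N Cv δ) (hCtV : VertexFamily CtV N Cc δ) (hW : VertexFamily₂ W N Cw δ) (hCtW : VertexFamily₂ CtW N Cc₂ δ)
    (hδ : 0 < δ) (hcov : BlockCovariant A V W N) (hAr : refK Φ A = A) (α : Fin D) (c : ℤ)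
    (hVr : ∀ μ y, V μ (bondRefl α c μ y) = reflSign α μ • refK Φ (V μ y + CtV μ y))
    (hWr : ∀ μ y ν y', W μ (bondRefl α c μ y) ν (bondRefl α c ν y') = (reflSign α μ * reflSign α ν) • refK Φ (W μ y ν y' + CtW μ y ν y'))
    (μ ν : Fin D) (z : Fin D → ℤ) :
    hessKer A V W μ ν (axisReflect α z + (if μ = α then unitVec α else 0) - (if ν = α then unitVec α else 0))
      = reflSign α μ * reflSign α ν * (hessKer A V W μ ν z + (1 / 2) * tadpole A (CtW μ 0 ν z)
          - (1 / 2) * (bubble A (CtV μ 0) (V ν z) + bubble A (V μ 0) (CtV ν z) + bubble A (CtV μ 0) (CtV ν z))) := by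
  have h := hess_refl_bdd_contact₂ Φ hA hV hCtV hW hCtW hδ hAr (bondRefl α c) (reflSign α) hVr hWr μ 0 ν z
  rw [hess_eq_hessKer hcov, hess_eq_hessKer hcov, sub_zero, bondRefl_sub, sub_zero] at h
  exact h

/-! ## §4 The covariance corollary under the consistency identity -/

/-- [folklore] **`AxisReflectionCovariant (fun μ ν z => hessKer A V W μ ν (−z))` FROM TWO LAWS WITH CONTACT AND ONE CONSISTENCY IDENTITY**: bounded leg, localised vertex families,
block covariance, and for every axis `α` a leg relabelling `Φα` (leaving the leg invariant), an offset `c` and contact families `CtVα`, `CtWα` such that the first-order family obeys the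
law with contact `CtVα`, the second-order family the law with contact `CtWα`, and THE W-CONTACT's TADPOLE EQUALS THE SUM OF THE THREE V-CONTACT CROSS WORDS at every `(μ, ν, z)`:
`tadpole A (CtWα μ 0 ν z) = bubble A (CtVα μ 0) (V ν z) + bubble A (V μ 0) (CtVα ν z) + bubble A (CtVα μ 0) (CtVα ν z)`.  (`KernelReflectionBoundedContact` §4 = the case `CtWα = 0`.)
For the BF data `CtVα = −[·=α]·[Π, M]` with `A∘M = M∘A = 1` ((P-INV)) the right member is a sum of LOCAL words; the identity is the statement that the `(2,2)` jet's contact is the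
`B`-derivative of the `(2,1)` jet's — the consumer's rule. -/
theorem axisReflectionCovariant_flip_hessKer_bdd_contact₂ {A : MKer D F} {V : Fin D → (Fin D → ℤ) → MKer D F}
    {W : Fin D → (Fin D → ℤ) → Fin D → (Fin D → ℤ) → MKer D F} {B Cv Cc Cw Cc₂ δ : ℝ} {N : ℕ}
    (hA : Bdd A B) (hV : VertexFamily V N Cv δ) (hW : VertexFamily₂ W N Cw δ) (hδ : 0 < δ) (hcov : BlockCovariant A V W N)
    (hAr : ∀ α : Fin D, ∃ Φα : LegMap D F, refK Φα A = A ∧ ∃ c : ℤ, ∃ CtVα : Fin D → (Fin D → ℤ) → MKer D F,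
      ∃ CtWα : Fin D → (Fin D → ℤ) → Fin D → (Fin D → ℤ) → MKer D F, VertexFamily CtVα N Cc δ ∧ VertexFamily₂ CtWα N Cc₂ δ ∧
      (∀ μ y, V μ (bondRefl α c μ y) = reflSign α μ • refK Φα (V μ y + CtVα μ y)) ∧
      (∀ μ y ν y', W μ (bondRefl α c μ y) ν (bondRefl α c ν y') = (reflSign α μ * reflSign α ν) • refK Φα (W μ y ν y' + CtWα μ y ν y')) ∧
      (∀ μ ν z, tadpole A (CtWα μ 0 ν z) =
        bubble A (CtVα μ 0) (V ν z) + bubble A (V μ 0) (CtVα ν z) + bubble A (CtVα μ 0) (CtVα ν z))) :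
    AxisReflectionCovariant (fun μ ν z => hessKer A V W μ ν (-z)) := by
  intro α μ ν z
  obtain ⟨Φα, hA', c, CtVα, CtWα, hCtV, hCtW, hVr, hWr, hX⟩ := hAr α
  have h := hessKer_refl_bdd_contact₂ Φα hA hV hCtV hW hCtW hδ hcov hA' α c hVr hWr μ ν (-z)
  rw [hX μ ν (-z)] at h
  have e : -(axisReflect α z - (if μ = α then unitVec α else 0) + (if ν = α then unitVec α else 0))
      = axisReflect α (-z) + (if μ = α then unitVec α else 0) - (if ν = α then unitVec α else 0) := by
    funext i
    simp only [Pi.neg_apply, Pi.sub_apply, Pi.add_apply, axisReflect_apply]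
    by_cases hi : i = α <;> by_cases hμ : μ = α <;> by_cases hν : ν = α <;> simp [hi, hμ, hν, unitVec_apply] <;> ring
  show hessKer A V W μ ν (-(axisReflect α z - (if μ = α then unitVec α else 0) + (if ν = α then unitVec α else 0)))
    = reflSign α μ * reflSign α ν * hessKer A V W μ ν (-z)
  rw [e, h]
  ring

end Summit.QuantumFields.BalabanUV.Beta.FP.KernelReflectionBoundedContact2

end
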